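import Mathlib
import HarnessLib

/-!
# Crux `OddMorawetz.MorawetzKillsTypeI` (stmt-NavierStokesRegularity-1377), line `birth`:
  stub `stub_weightOne_average` — the hyperoctahedral average of a weight-one density

A weight-one cubic jet density has the shape `∑ τ i j p q * a i * a j * A p q` (`a = v(x)`,
`A = ∇v(x)`).  Its transform by the signed permutation `(s, π)` of `ℝ³` (`s : Fin 3 → Bool` a sign
vector, `σ c = if s c then 1 else -1`, `π ∈ S₃`; the 48 elements of the hyperoctahedral group `B₃`)
has coefficients `σ (π i) σ (π j) σ (π p) σ (π q) * τ (π i) (π j) (π p) (π q)`.  The SUM over `B₃`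
is the isotropic-plus-cubic form
`8 [𝛂 |a|² tr A + (𝛃 + 𝛄) Σᵢⱼ aᵢ aⱼ Aᵢⱼ + (2𝛋₀ − 𝛂 − 𝛃 − 𝛄) Σᵢ aᵢ² Aᵢᵢ]`,
`𝛂 = Σ_{p≠q} τ p p q q`, `𝛃 = Σ_{p≠q} τ p q p q`, `𝛄 = Σ_{p≠q} τ p q q p`, `𝛋₀ = Σ_p τ p p p p`
(`stub_weightOne_average`).

Proof (pure finite algebra over `ℝ`):
* SIGN SUM (`WeightOneAverage.signSum`): for fixed indices `c₁ c₂ c₃ c₄ : Fin 3`,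
  `Σ_s σ c₁ σ c₂ σ c₃ σ c₄ = 8` when every value occurs an even number of times among the `cₜ`
  (`(c₁ = c₂ ∧ c₃ = c₄) ∨ (c₁ = c₃ ∧ c₂ = c₄) ∨ (c₁ = c₄ ∧ c₂ = c₃)`) and `= 0` otherwise — the sum
  over `Fin 3 → Bool` is a triple sum over `Bool` (`WeightOneAverage.sum_arrow_fin_three`) and the
  `81` index patterns are checked by `fin_cases`/`norm_num`; the pattern predicate is invariant
  under the injective `π`.
* PERMUTATION SUM (`WeightOneAverage.sum_perm_fin_three`): the six permutations of `Fin 3` are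
  `1, (0 1), (0 2), (1 2), (0 1)(1 2), (1 2)(0 1)` (`decide`), so a sum over `S₃` is six explicit
  terms.
* The stub: exchange `Σ_s` and `Σ_π`, expand the index sums (`Fin.sum_univ_three`), evaluate the
  sign sums, discard the `60` odd patterns, expand the permutation sum and close with `ring`.

Elementary; no published source needed.  Lands `--supports stmt-NavierStokesRegularity-1377`.
-/

-- the summit and its single problem share the name (D-0017 nested layout)
set_option linter.dupNamespace false

namespace Summit.NavierStokesRegularity.NavierStokesRegularity.Theorems

namespace WeightOneAverage

open Equiv

/-- The six permutations of `Fin 3`, listed explicitly: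
`S₃ = {1, (0 1), (0 2), (1 2), (0 1)(1 2), (1 2)(0 1)}`. -/
theorem univ_perm_fin_three : (Finset.univ : Finset (Equiv.Perm (Fin 3))) =
    {1, swap 0 1, swap 0 2, swap 1 2, swap 0 1 * swap 1 2, swap 1 2 * swap 0 1} := by
  decide

/-- A sum over `S₃` is the sum of six explicit terms. -/
theorem sum_perm_fin_three (f : Equiv.Perm (Fin 3) → ℝ) :
    ∑ π, f π = f 1 + f (swap 0 1) + f (swap 0 2) + f (swap 1 2) + f (swap 0 1 * swap 1 2)
      + f (swap 1 2 * swap 0 1) := by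
  rw [univ_perm_fin_three, Finset.sum_insert (by decide), Finset.sum_insert (by decide),
    Finset.sum_insert (by decide), Finset.sum_insert (by decide), Finset.sum_insert (by decide),
    Finset.sum_singleton]
  ring

/-- A sum over the sign vectors `Fin 3 → Bool` is a triple sum over `Bool`. -/
theorem sum_arrow_fin_three (f : (Fin 3 → Bool) → ℝ) :
    ∑ s, f s = ∑ b₀, ∑ b₁, ∑ b₂, f ![b₀, b₁, b₂] := by
  have hb : Function.Bijective
      (fun b : Bool × Bool × Bool => (![b.1, b.2.1, b.2.2] : Fin 3 → Bool)) := by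
    refine ⟨fun b b' h => ?_, fun s => ⟨(s 0, s 1, s 2), ?_⟩⟩
    · have h0 := congrFun h 0
      have h1 := congrFun h 1
      have h2 := congrFun h 2
      simp only [Matrix.cons_val_zero, Matrix.cons_val_one, Matrix.head_cons,
        Matrix.cons_val_two, Matrix.tail_cons] at h0 h1 h2
      exact Prod.ext h0 (Prod.ext h1 h2)
    · funext i
      fin_cases i <;> rfl
  rw [← hb.sum_comp]
  simp only [Fintype.sum_prod_type]

/-- **Sign sum.** For fixed indices `i j p q : Fin 3`, the sum over all sign vectors `s` of
`σ i σ j σ p σ q` (`σ c = if s c then 1 else -1`) is `8` when every value of `Fin 3` occurs an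
even number of times among `(i, j, p, q)`, i.e.
`(i = j ∧ p = q) ∨ (i = p ∧ j = q) ∨ (i = q ∧ j = p)`, and `0` otherwise (some value occurs an
odd number of times and flipping its sign is a sign-reversing involution).  Checked over the
`81` index patterns. -/
theorem signSum (i j p q : Fin 3) :
    ∑ s : Fin 3 → Bool, (if s i then (1 : ℝ) else -1) * (if s j then (1 : ℝ) else -1) *
        (if s p then (1 : ℝ) else -1) * (if s q then (1 : ℝ) else -1)
      = if (i = j ∧ p = q) ∨ (i = p ∧ j = q) ∨ (i = q ∧ j = p) then 8 else 0 := by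
  rw [sum_arrow_fin_three]
  simp only [Fintype.sum_bool]
  fin_cases i <;> fin_cases j <;> fin_cases p <;> fin_cases q <;> norm_num

/-- The sign sum inside a product, with permuted indices: for `π ∈ S₃` the pattern predicate of
`(π i, π j, π p, π q)` is that of `(i, j, p, q)` (`π` is injective). -/
theorem sum_mul_signs_mul (π : Equiv.Perm (Fin 3)) (i j p q : Fin 3) (x y : ℝ) :
    ∑ s : Fin 3 → Bool, x * ((if s (π i) then (1 : ℝ) else -1) *
        (if s (π j) then (1 : ℝ) else -1) * (if s (π p) then (1 : ℝ) else -1) *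
        (if s (π q) then (1 : ℝ) else -1)) * y
      = x * (if (i = j ∧ p = q) ∨ (i = p ∧ j = q) ∨ (i = q ∧ j = p) then 8 else 0) * y := by
  rw [← Finset.sum_mul, ← Finset.mul_sum, signSum]
  simp only [EmbeddingLike.apply_eq_iff_eq]

/-- The index sums after the sign sum: only the paired patterns `(i = j, p = q)`, `(i = p, j = q)`,
`(i = q, j = p)` survive, the all-equal pattern being counted `3 - 2 = 1` times. -/
theorem sum_pattern_eq (τ : Fin 3 → Fin 3 → Fin 3 → Fin 3 → ℝ) (a : Fin 3 → ℝ)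
    (A : Fin 3 → Fin 3 → ℝ) (π : Equiv.Perm (Fin 3)) :
    ∑ i, ∑ j, ∑ p, ∑ q, τ (π i) (π j) (π p) (π q) *
        (if (i = j ∧ p = q) ∨ (i = p ∧ j = q) ∨ (i = q ∧ j = p) then 8 else 0) *
        (a i * a j * A p q)
      = 8 * (∑ i, ∑ p, τ (π i) (π i) (π p) (π p) * (a i * a i * A p p))
        + 8 * (∑ i, ∑ j, τ (π i) (π j) (π i) (π j) * (a i * a j * A i j))
        + 8 * (∑ i, ∑ j, τ (π i) (π j) (π j) (π i) * (a i * a j * A j i))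
        - 16 * ∑ i, τ (π i) (π i) (π i) (π i) * (a i * a i * A i i) := by
  simp only [Fin.sum_univ_three, Fin.reduceEq, and_true, and_false, or_self, or_false, false_or,
    if_true, if_false, mul_zero, zero_mul, add_zero, zero_add]
  ring

end WeightOneAverage

open WeightOneAverage in
/-- **The hyperoctahedral average of a weight-one density is isotropic up to a cubic term**
(stub `stub_weightOne_average` of the line `birth` of the crux `OddMorawetz.MorawetzKillsTypeI`).
Summing the signed-permutation transforms
`(s, π) · τ = (i j p q) ↦ σ (π i) σ (π j) σ (π p) σ (π q) τ (π i) (π j) (π p) (π q)`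
(`σ = ±1` from `s : Fin 3 → Bool`, `π ∈ S₃`; 48 elements) of any coefficient tensor `τ`, contracted
with `a i * a j * A p q`, gives
`8 [𝛂 |a|² tr A + (𝛃 + 𝛄) Σᵢⱼ aᵢ aⱼ Aᵢⱼ + (2𝛋₀ − 𝛂 − 𝛃 − 𝛄) Σᵢ aᵢ² Aᵢᵢ]` with
`𝛂 = Σ_{p≠q} τ p p q q`, `𝛃 = Σ_{p≠q} τ p q p q`, `𝛄 = Σ_{p≠q} τ p q q p`, `𝛋₀ = Σ_p τ p p p p`.
Proof: the sign sum (`WeightOneAverage.signSum`) kills every index pattern in which some value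
occurs an odd number of times; the surviving `21` patterns are summed over the six explicit
permutations (`WeightOneAverage.sum_perm_fin_three`) and compared by `ring`. -/
theorem stub_weightOne_average :
    ∀ (τ : Fin 3 → Fin 3 → Fin 3 → Fin 3 → ℝ) (a : Fin 3 → ℝ) (A : Fin 3 → Fin 3 → ℝ),
      (∑ s : Fin 3 → Bool, ∑ π : Equiv.Perm (Fin 3), ∑ i, ∑ j, ∑ p, ∑ q,
          τ (π i) (π j) (π p) (π q) *
            ((if s (π i) then (1 : ℝ) else -1) * (if s (π j) then (1 : ℝ) else -1) *
              (if s (π p) then (1 : ℝ) else -1) * (if s (π q) then (1 : ℝ) else -1)) *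
            (a i * a j * A p q)) =
        8 * (∑ p, ∑ q, if p = q then 0 else τ p p q q) * ((∑ i, a i ^ 2) * ∑ p, A p p) +
        8 * ((∑ p, ∑ q, if p = q then 0 else τ p q p q) + ∑ p, ∑ q, if p = q then 0 else τ p q q p) *
            (∑ i, ∑ j, a i * a j * A i j) +
        8 * (2 * (∑ p, τ p p p p) - (∑ p, ∑ q, if p = q then 0 else τ p p q q) -
              (∑ p, ∑ q, if p = q then 0 else τ p q p q) - ∑ p, ∑ q, if p = q then 0 else τ p q q p) *
            (∑ i, a i ^ 2 * A i i) := by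
  intro τ a A
  -- exchange `Σ_s` with `Σ_π` and the index sums, and evaluate the sign sums
  have hS : (∑ s : Fin 3 → Bool, ∑ π : Equiv.Perm (Fin 3), ∑ i, ∑ j, ∑ p, ∑ q,
      τ (π i) (π j) (π p) (π q) *
        ((if s (π i) then (1 : ℝ) else -1) * (if s (π j) then (1 : ℝ) else -1) *
          (if s (π p) then (1 : ℝ) else -1) * (if s (π q) then (1 : ℝ) else -1)) *
        (a i * a j * A p q)) =
      ∑ π : Equiv.Perm (Fin 3), ∑ i, ∑ j, ∑ p, ∑ q, τ (π i) (π j) (π p) (π q) *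
        (if (i = j ∧ p = q) ∨ (i = p ∧ j = q) ∨ (i = q ∧ j = p) then 8 else 0) *
        (a i * a j * A p q) := by
    rw [Finset.sum_comm]
    refine Finset.sum_congr rfl fun π _ => ?_
    rw [Finset.sum_comm]
    refine Finset.sum_congr rfl fun i _ => ?_
    rw [Finset.sum_comm]
    refine Finset.sum_congr rfl fun j _ => ?_
    rw [Finset.sum_comm]
    refine Finset.sum_congr rfl fun p _ => ?_
    rw [Finset.sum_comm]
    refine Finset.sum_congr rfl fun q _ => ?_
    exact sum_mul_signs_mul π i j p q _ _
  rw [hS, Finset.sum_congr rfl fun π _ => sum_pattern_eq τ a A π, sum_perm_fin_three]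
  simp only [Fin.sum_univ_three, Equiv.Perm.mul_apply, Equiv.Perm.one_apply,
    Equiv.swap_apply_def, Fin.reduceEq, if_true, if_false]
  ring

end Summit.NavierStokesRegularity.NavierStokesRegularity.Theorems
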